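import Summits.PneNP.PneNP.Theses.SzkEntropy
import Summits.PneNP.PneNP.Theorems.SzkEntropyPeaThreeNotInP
import Summits.PneNP.PneNP.Theorems.SzkEntropyPeaThreeNotInPKillSwitch
import Literature.Computability.Complexity.PolynomialEntropyApproximation
import Literature.Computability.Complexity.PEADegreeReduction
import Literature.Computability.Complexity.PromiseCookReductionsProofs
import Literature.Computability.Cryptography.BranchingProgramEncoding

/-!
# Sketch (crux-ideate stmt-PneNP-10776, ideator 2, round 1) — first lemmas of card
`entropy-gap-sockets`

Crux: `Summit.PneNP.PneNP.Theses.SzkEntropy.PeaThreeNotInP` (= `PEA 3 ∉ PromiseP`).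

Contents (all over existing declarations):
* §1 the SOCKET LEMMAS (proved here): any promise problem Cook-reducible to `PEA 3` that is
  outside `PromiseP` (resp. outside `PromiseBPP'`) yields the crux (resp. the stronger
  `¬ PeaThreeMemBPP`, hence the crux);
* §2 the GAP-COMPILATION LEMMA (proved here): an `FP` map sending yes/no instances of `Q` to
  sparse polynomial maps of ANY fixed degree `d` with a certified one-bit Shannon-entropy gap is a
  Karp reduction `Q ≤ₚ PEA 3` (degree reduction `PEA d ≤ₚ PEA 3` is the tree theorem
  `PEA_polyTimeReducible_PEA_three`);
* §3 the first NEW socket as a statement: 3-tensor isomorphism over `F₂` (`TensorIso`, defined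
  here on support-list instances) Cook-reduces to `PEA 3` (stub, to be proved via perfect
  degree-3 randomizing polynomials for MOD-2 branching programs, AIK Lemma 4.15, applied to the
  GL³-orbit samplers; the tree has the deterministic-BP case `entropy_encodeBDDsMap`), and the
  resulting conditional corollary `TensorIso ∉ PromiseP → PeaThreeNotInP`.
-/

namespace Summit.PneNP.PneNP.Cruxes.PeaThreeNotInP.EntropyGapSockets

open Literature.Computability.Complexity
open Summit.PneNP.PneNP.Theses.SzkEntropy
open _root_.Computability

/-! ### §1 Socket lemmas -/

/-- **Socket lemma, `P` form.** If some promise problem `Q` Cook-reduces to `PEA 3` and is not in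
promise-`P`, then `PEA 3 ∉ PromiseP`, i.e. the crux `PeaThreeNotInP`. -/
theorem peaThreeNotInP_of_cookSocket {Q : PromiseProblem}
    (hQ : Q.CookReducible (PEA 3)) (hhard : Q ∉ PromiseP) : PeaThreeNotInP :=
  Summit.PneNP.PneNP.Theorems.szkEntropy_peaThreeNotInP_iff.2 fun h3 =>
    hhard (PromiseProblem.mem_PromiseP_of_cookReducible_holds Q (PEA 3) hQ h3)

/-- **Socket lemma, Karp form.** -/
theorem peaThreeNotInP_of_karpSocket {Q : PromiseProblem}
    (hQ : Q.PolyTimeReducible (PEA 3)) (hhard : Q ∉ PromiseP) : PeaThreeNotInP :=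
  peaThreeNotInP_of_cookSocket hQ.cookReducible hhard

/-- **Socket lemma, `BPP` form** (stronger conclusion: the kill switch fails). If `Q`
Cook-reduces to `PEA 3` and `Q ∉ PromiseBPP'`, then `¬ PeaThreeMemBPP` (`PEA 3 ∉ PromiseBPP'`). -/
theorem not_peaThreeMemBPP_of_cookSocket {Q : PromiseProblem}
    (hQ : Q.CookReducible (PEA 3)) (hhard : Q ∉ PromiseBPP') : ¬ PeaThreeMemBPP := fun h =>
  hhard (PromiseProblem.mem_PromiseBPP'_of_cookReducible_holds Q (PEA 3) hQ
    (Summit.PneNP.PneNP.Theorems.szkEntropy_peaThreeMemBPP_iff.1 h))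

/-- … hence the crux, through the tree theorem `¬ PeaThreeMemBPP → PeaThreeNotInP`. -/
theorem peaThreeNotInP_of_cookSocket_bpp {Q : PromiseProblem}
    (hQ : Q.CookReducible (PEA 3)) (hhard : Q ∉ PromiseBPP') : PeaThreeNotInP :=
  Summit.PneNP.PneNP.Theorems.szkEntropy_peaThreeNotInP_of_not_peaThreeMemBPP
    (not_peaThreeMemBPP_of_cookSocket hQ hhard)

/-! ### §2 Gap compilation: certified one-bit entropy gaps are Karp reductions to `PEA 3` -/

/-- **Gap-compilation lemma.** An `FP` map `w ↦ (n_w, p_w, k_w)` into sparse polynomial maps of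
some fixed syntactic degree `d`, with `H(p_w(U)) ≥ k_w + 1` on yes-instances and
`H(p_w(U)) ≤ k_w` on no-instances of `Q`, is a Karp reduction `Q ≤ₚ PEA 3` (any `d`: compose
with the tree's degree reduction `PEA d ≤ₚ PEA 3`). -/
theorem polyTimeReducible_PEA_three_of_entropyGap {Q : PromiseProblem} (d : ℕ)
    (f : List Bool → PEAInst) (hf : (fun w => PEAInst.encoding.encode (f w)) ∈ FP)
    (hdeg : ∀ w, (f w).2.1.DegLE d)
    (hyes : ∀ w ∈ Q.yes, ((f w).2.2 : ℝ) + 1 ≤ (f w).2.1.entropy)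
    (hno : ∀ w ∈ Q.no, (f w).2.1.entropy ≤ ((f w).2.2 : ℝ)) :
    Q.PolyTimeReducible (PEA 3) :=
  PromiseProblem.PolyTimeReducible.trans_holds
    ⟨fun w => PEAInst.encoding.encode (f w), hf,
      fun w hw => (encode_mem_PEA_yes_iff d (f w)).2 ⟨hdeg w, hyes w hw⟩,
      fun w hw => (encode_mem_PEA_no_iff d (f w)).2 ⟨hdeg w, hno w hw⟩⟩
    (PEA_polyTimeReducible_PEA_three d)

/-- **Gap compilation gives the crux from worst-case hardness.** -/
theorem peaThreeNotInP_of_entropyGap {Q : PromiseProblem} (d : ℕ)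
    (f : List Bool → PEAInst) (hf : (fun w => PEAInst.encoding.encode (f w)) ∈ FP)
    (hdeg : ∀ w, (f w).2.1.DegLE d)
    (hyes : ∀ w ∈ Q.yes, ((f w).2.2 : ℝ) + 1 ≤ (f w).2.1.entropy)
    (hno : ∀ w ∈ Q.no, (f w).2.1.entropy ≤ ((f w).2.2 : ℝ))
    (hhard : Q ∉ PromiseP) : PeaThreeNotInP :=
  peaThreeNotInP_of_karpSocket (polyTimeReducible_PEA_three_of_entropyGap d f hf hdeg hyes hno)
    hhard

/-! ### §3 The tensor-isomorphism socket (statement) -/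

/-- Instances of 3-tensor isomorphism over `F₂`: a dimension `n` and two tensors, each given by a
list of index triples (the tensor entry is the number of occurrences mod `2`). -/
abbrev Tensor3Inst : Type := Σ n : ℕ, List (Fin n × (Fin n × Fin n)) × List (Fin n × (Fin n × Fin n))

/-- Boolean encoding of tensor-isomorphism instances. -/
def Tensor3Inst.encoding : Encoding Tensor3Inst Bool :=
  Encoding.sigmaBool fun n =>
    (((encodingFinBool n).pairBool ((encodingFinBool n).pairBool (encodingFinBool n))).listBool).pairBool
      (((encodingFinBool n).pairBool ((encodingFinBool n).pairBool (encodingFinBool n))).listBool)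

/-- The tensor `Fin n → Fin n → Fin n → F₂` presented by a support list. -/
def toTensor {n : ℕ} (S : List (Fin n × (Fin n × Fin n))) : Fin n → Fin n → Fin n → ZMod 2 :=
  fun i j k => (S.count (i, (j, k)) : ZMod 2)

/-- The action of a triple of matrices on a 3-tensor: `((A,B,C)·T)_{abc} = Σ A_{ai} B_{bj} C_{ck} T_{ijk}`. -/
def act {n : ℕ} (A B C : Matrix (Fin n) (Fin n) (ZMod 2)) (T : Fin n → Fin n → Fin n → ZMod 2) :
    Fin n → Fin n → Fin n → ZMod 2 :=
  fun a b c => ∑ i, ∑ j, ∑ k, A a i * B b j * C c k * T i j k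

/-- Two tensors are isomorphic if some triple of INVERTIBLE matrices carries one to the other. -/
def TensorIsomorphic {n : ℕ} (T₀ T₁ : Fin n → Fin n → Fin n → ZMod 2) : Prop :=
  ∃ A B C : Matrix (Fin n) (Fin n) (ZMod 2), IsUnit A ∧ IsUnit B ∧ IsUnit C ∧ act A B C T₀ = T₁

/-- **3-Tensor Isomorphism over `F₂`** (`TI`; Grochow–Qiao: complete for the class TI, which
contains matrix-code equivalence, alternating/symmetric trilinear form equivalence, cubic form
equivalence, algebra isomorphism, class-2 exponent-`p` group isomorphism in the matrix model) as a
promise problem with full promise: yes = isomorphic, no = not isomorphic. -/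
noncomputable def TensorIso : PromiseProblem :=
  PromiseProblem.ofEncoding Tensor3Inst.encoding
    {I | TensorIsomorphic (toTensor I.2.1) (toTensor I.2.2)}
    {I | ¬ TensorIsomorphic (toTensor I.2.1) (toTensor I.2.2)}

/-- **STUB (the new socket): `TI` Cook-reduces to `PEA 3`.** Route: the orbit samplers
`(A,B,C) ↦ (A,B,C)·T_b` (uniform matrices, product of random transvections) are mod-2 branching
programs of polynomial size, hence have PERFECT degree-3 randomizing polynomials (AIK Lemma 4.15,
mod-2 case; tree: deterministic case `entropy_encodeBDDsMap`); the pair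
`Z₁ = (g·T_c, g'·T_{c'})`, `Z₂ = (g·T_c, g'·T_c)` has `H(Z₁) − H(Z₂) = 1` (non-isomorphic) or
`0` (isomorphic), which two-fold products and one uniform padding bit turn into a `PED_3`
instance; `PED_3` reduces to `PEA 3` by ≤ 2 truth-table (hence Cook) queries [DGRV Thm 1.1 / §3]. -/
theorem tensorIso_cookReducible_PEA_three : TensorIso.swap.CookReducible (PEA 3) := by
  sorry

/-- **Conditional corollary (the socket in use): worst-case hardness of 3-tensor isomorphism over
`F₂` (for deterministic polynomial time) gives the crux.** (`PromiseP` is closed under `swap` of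
yes/no up to complementing the separating language; we state hardness for the swapped problem,
which is the form the reduction produces: yes = NON-isomorphic.) -/
theorem peaThreeNotInP_of_tensorIso_hard (hhard : TensorIso.swap ∉ PromiseP) : PeaThreeNotInP :=
  peaThreeNotInP_of_cookSocket tensorIso_cookReducible_PEA_three hhard

/-! ### §4 The Z₁/Z₂ entropy-difference gadget, abstractly (crux-plan stub (c); statements) -/

section Gadget

open Literature.InformationTheory.Entropy

variable {R Y : Type*} [Fintype R] [DecidableEq Y]

/-- `Z₁`: two INDEPENDENT hidden bits — `(c, c', r, r') ↦ (S_c r, S_{c'} r')`. -/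
def Z1 (S₀ S₁ : R → Y) : Bool × Bool × R × R → Y × Y :=
  fun q => ((if q.1 then S₁ q.2.2.1 else S₀ q.2.2.1), (if q.2.1 then S₁ q.2.2.2 else S₀ q.2.2.2))

/-- `Z₂`: ONE hidden bit shared by both coordinates — `(c, r, r') ↦ (S_c r, S_c r')`. -/
def Z2 (S₀ S₁ : R → Y) : Bool × R × R → Y × Y :=
  fun q => ((if q.1 then S₁ q.2.1 else S₀ q.2.1), (if q.1 then S₁ q.2.2 else S₀ q.2.2))

/-- **Gadget, isomorphic case.** If the two samplers have the same law because one is a re-indexing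
of the other by a bijection of the coin space (the orbit situation: `g·T₁ = (g h)·T₀` and `g ↦ g h`
is a bijection), then `H(Z₁) = H(Z₂)`. -/
theorem mapEntropy_Z1_eq_Z2_of_equiv (S₀ S₁ : R → Y) (σ : R ≃ R) (h : S₁ = S₀ ∘ σ) :
    mapEntropy Finset.univ (Z1 S₀ S₁) = mapEntropy Finset.univ (Z2 S₀ S₁) := by
  sorry

/-- **Gadget, non-isomorphic case.** If the two samplers have DISJOINT ranges (disjoint orbits),
then `H(Z₁) = H(Z₂) + 1`: in `Z₁` the pair of orbit labels carries 2 bits, in `Z₂` one bit, and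
given the labels the coordinates are independent with the same conditional entropies. -/
theorem mapEntropy_Z1_eq_Z2_add_one_of_disjoint [Nonempty R] (S₀ S₁ : R → Y)
    (h : ∀ r r', S₀ r ≠ S₁ r') :
    mapEntropy Finset.univ (Z1 S₀ S₁) = mapEntropy Finset.univ (Z2 S₀ S₁) + 1 := by
  sorry

end Gadget

end Summit.PneNP.PneNP.Cruxes.PeaThreeNotInP.EntropyGapSockets
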